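import Mathlib
import HarnessLib
import Summits.AtomisticToContinuum.FouriersLaw.Theses.JunctionLocality
import Summits.AtomisticToContinuum.FouriersLaw.Theorems.JunctionLocalitySuperadditiveResistanceDeviceLiouville
import Summits.AtomisticToContinuum.FouriersLaw.Theorems.JunctionLocalitySuperadditiveResistanceKuboCutoff
import Literature.Barriers.AtomisticToContinuum.MacroErgodicityHypothesis

/-!
# Contact formation, Ia: pointwise algebra of the curl certificate — coordinate calculus and the contact forces

Helper file (`--supports` stmt-AtomisticToContinuum-11749) for stub `stub_contactFormation` (R4) of the line
`cold-bath-relocation-walk` of the crux `JunctionLocality.ConductanceLowerBound` (lead c2 worker). Part Ia of the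
contact-certificate development (`…ContactCertificateAlgebra`, `…AlgebraAux1`, `…Bounds`, `…Moments`, `…Pairing`,
`…StubContactFormation`).

Setting: the pinned anharmonic chain `P = pinnedChain ω₂ lam β γ` on `L ≥ 2` sites, `H` its Hamiltonian,
`F_i = −∂_{q_i} H` the force on site `i`, `X_H = liouvilleOp P L`. Everything here is POINTWISE (no measure theory):

* coordinate calculus of `partialQ`/`partialP` on functions of one or two coordinates (`contact_partialQ_comp_fst`,
  `contact_partialQ_comp_sub`, linearity, `X_H p_i = −∂_{q_i}H`, `X_H G(q) = Σ_j p_j ∂_{q_j} G`);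
* the two contact forces in closed form: `∂_{q_0}H = U'(q_0) − V'(q_1 − q_0)` and
  `∂_{q_1}H = U'(q_1) + V'(q_1 − q_0) − ε V'(q_{j₂} − q_1)` with a third site `j₂ ≠ 0` and `ε ∈ {0, 1}` (`ε = 0` iff
  `L = 2`), uniformly in `L ≥ 2` (`contact_forcesClosedForm`, the registered helper) — the only place where the passive
  tail enters the certificate;
* smoothness and momentum-independence of `F_0 = −U'(q_0) + V'(q_1 − q_0)`,
  `F_1 = −U'(q_1) − V'(q_1 − q_0) + εV'(q_{j₂} − q_1)` (kept symbolic in `U', V'`; `V'' = 1 + 3βr² ≥ 1`).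

The coordinate derivatives of the forces, `X_H F_i`, the curl identity and the test function `φ = p_0F_1 − p_1F_0` are in
`…ContactCertificateAlgebraAux1`. References: folklore (calculus).
-/

noncomputable section

open MeasureTheory Filter Topology
open scoped ContDiff
open Literature.MathematicalPhysics.KineticTheory.HeatConduction
open Summit.AtomisticToContinuum.FouriersLaw.Theorems.SuperadditiveResistance.DeviceLiouville
  (kin thermo liouvilleOp bathOp thermo_eq kin_eq_sq partialP_mul partialQ_mul partialP_sub partialQ_sub
    liouvilleOp_sub lineP lineQ differentiable_lineP differentiable_lineQ partialP_eq_deriv_lineP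
    partialQ_eq_deriv_lineQ lineP_apply_self lineQ_apply_self partialP_const partialQ_const)
open Summit.AtomisticToContinuum.FouriersLaw.Theorems.SuperadditiveResistance.Kubo (liouvilleOp_mul)
open Literature.Barriers.AtomisticToContinuum (pinnedChain_deriv_deriv_U)

namespace Summit.AtomisticToContinuum.FouriersLaw.Cruxes.ConductanceLowerBound.ColdBathRelocationWalk

/-! ## Coordinate calculus -/

section CoordinateCalculus

variable {L : ℕ}

/-- `∂_{q_j} F(q_i) = [i = j] F'(q_i)` (no differentiability needed). [folklore] -/
theorem contact_partialQ_comp_fst (F : ℝ → ℝ) (i j : Fin L) (x : PhaseSpace L) :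
    partialQ j (fun y => F (y.1 i)) x = if i = j then deriv F (x.1 i) else 0 := by
  unfold partialQ
  by_cases h : i = j
  · subst h
    simp
  · simp [h]

/-- `∂_{q_j} F(q_i − q_k) = F'(q_i − q_k) ([i = j] − [k = j])` (no differentiability needed). [folklore] -/
theorem contact_partialQ_comp_sub (F : ℝ → ℝ) (i k j : Fin L) (x : PhaseSpace L) :
    partialQ j (fun y => F (y.1 i - y.1 k)) x =
      deriv F (x.1 i - x.1 k) * ((if i = j then 1 else 0) - (if k = j then 1 else 0)) := by
  unfold partialQ
  by_cases hi : i = j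
  · subst hi
    by_cases hk : k = i
    · subst hk
      simp
    · simp only [Function.update_self, Function.update_of_ne hk, if_true, if_neg hk, sub_zero, mul_one]
      rw [deriv_comp_sub_const]
  · by_cases hk : k = j
    · subst hk
      simp only [Function.update_self, Function.update_of_ne hi, if_neg hi, if_true, zero_sub, mul_neg,
        mul_one]
      rw [deriv_comp_const_sub]
    · simp [hi, hk]

/-- A function of the positions only has vanishing momentum derivatives. [folklore] -/
theorem contact_partialP_of_fst (G : (Fin L → ℝ) → ℝ) (j : Fin L) (x : PhaseSpace L) :
    partialP j (fun y => G y.1) x = 0 := by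
  simp [partialP]

/-- A function of the momenta only has vanishing position derivatives. [folklore] -/
theorem contact_partialQ_of_snd (G : (Fin L → ℝ) → ℝ) (j : Fin L) (x : PhaseSpace L) :
    partialQ j (fun y => G y.2) x = 0 := by
  simp [partialQ]

/-- `∂_{p_j} p_i = [i = j]`. [folklore] -/
theorem contact_partialP_snd (i j : Fin L) (x : PhaseSpace L) :
    partialP j (fun y => y.2 i) x = if i = j then 1 else 0 := by
  unfold partialP
  by_cases h : i = j
  · subst h
    simp
  · simp [h]

/-- `Σ_j p_j [i = j] = p_i`. [folklore] -/
theorem contact_sum_mul_ite (p : Fin L → ℝ) (i : Fin L) :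
    ∑ j, p j * (if i = j then (1 : ℝ) else 0) = p i := by
  simp [Finset.sum_ite_eq]

/-- The momentum coordinate `p_i` is smooth. [folklore] -/
theorem contact_contDiff_snd {n : WithTop ℕ∞} (i : Fin L) : ContDiff ℝ n fun y : PhaseSpace L => y.2 i :=
  (contDiff_apply ℝ ℝ i).comp contDiff_snd

/-- The position coordinate `q_i` is smooth. [folklore] -/
theorem contact_contDiff_fst {n : WithTop ℕ∞} (i : Fin L) : ContDiff ℝ n fun y : PhaseSpace L => y.1 i :=
  (contDiff_apply ℝ ℝ i).comp contDiff_fst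

/-- `X_H p_i = −∂_{q_i} H`. [folklore] -/
theorem contact_liouvilleOp_snd (P : OscillatorChain) (i : Fin L) (x : PhaseSpace L) :
    liouvilleOp P L (fun y => y.2 i) x = -partialQ i (P.hamiltonian L) x := by
  unfold liouvilleOp
  simp only [contact_partialQ_of_snd (fun p => p i), contact_partialP_snd, mul_zero, zero_sub, mul_ite, mul_one,
    mul_zero]
  rw [Finset.sum_neg_distrib, Finset.sum_ite_eq]
  simp

/-- `X_H` of a function of the positions only: `X_H G = Σ_j p_j ∂_{q_j} G`. [folklore] -/
theorem contact_liouvilleOp_of_fst (P : OscillatorChain) (G : (Fin L → ℝ) → ℝ) (x : PhaseSpace L) :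
    liouvilleOp P L (fun y => G y.1) x = ∑ j, x.2 j * partialQ j (fun y => G y.1) x := by
  unfold liouvilleOp
  simp [contact_partialP_of_fst]

/-- `∂_{q_i}` is additive on differentiable functions. [folklore] -/
theorem contact_partialQ_add {f g : PhaseSpace L → ℝ} (hf : Differentiable ℝ f) (hg : Differentiable ℝ g)
    (i : Fin L) (x : PhaseSpace L) :
    partialQ i (fun y => f y + g y) x = partialQ i f x + partialQ i g x := by
  have h := ((differentiable_lineQ hf i x (x.1 i)).hasDerivAt.add
    (differentiable_lineQ hg i x (x.1 i)).hasDerivAt).deriv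
  rw [partialQ_eq_deriv_lineQ, partialQ_eq_deriv_lineQ, partialQ_eq_deriv_lineQ, ← h]
  rfl

/-- `∂_{q_i} (c f) = c ∂_{q_i} f` (unconditionally). [folklore] -/
theorem contact_partialQ_const_mul (c : ℝ) (f : PhaseSpace L → ℝ) (i : Fin L) (x : PhaseSpace L) :
    partialQ i (fun y => c * f y) x = c * partialQ i f x := by
  unfold partialQ
  exact deriv_const_mul_field c

/-- `∂_{p_i} (c f) = c ∂_{p_i} f` (unconditionally). [folklore] -/
theorem contact_partialP_const_mul (c : ℝ) (f : PhaseSpace L → ℝ) (i : Fin L) (x : PhaseSpace L) :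
    partialP i (fun y => c * f y) x = c * partialP i f x := by
  unfold partialP
  exact deriv_const_mul_field c

/-- `∂_{q_i} (−f) = −∂_{q_i} f` (unconditionally). [folklore] -/
theorem contact_partialQ_neg (f : PhaseSpace L → ℝ) (i : Fin L) (x : PhaseSpace L) :
    partialQ i (fun y => -f y) x = -partialQ i f x := by
  unfold partialQ
  exact deriv.neg

/-- `∂_{p_i} (−f) = −∂_{p_i} f` (unconditionally). [folklore] -/
theorem contact_partialP_neg (f : PhaseSpace L → ℝ) (i : Fin L) (x : PhaseSpace L) :
    partialP i (fun y => -f y) x = -partialP i f x := by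
  unfold partialP
  exact deriv.neg

/-- `X_H` of a function with vanishing momentum derivatives: `X_H f = Σ_j p_j ∂_{q_j} f`. [folklore] -/
theorem contact_liouvilleOp_of_partialP_eq_zero (P : OscillatorChain) {f : PhaseSpace L → ℝ}
    (hf : ∀ j x, partialP j f x = 0) (x : PhaseSpace L) :
    liouvilleOp P L f x = ∑ j, x.2 j * partialQ j f x := by
  unfold liouvilleOp
  simp [hf]

end CoordinateCalculus

/-! ## The two contact forces of the pinned chain in closed form -/

section Forces

variable {ω₂ lam β γ : ℝ} {L : ℕ}

/-- `∂_{q_0} H = U'(q_0) − V'(q_1 − q_0)` for `L ≥ 2` (site `0` has no left neighbour). [folklore] -/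
theorem contact_partialQ_hamiltonian_zero (hL : 2 ≤ L) {i0 i1 : Fin L} (hi0 : i0.val = 0) (hi1 : i1.val = 1)
    (x : PhaseSpace L) :
    partialQ i0 ((pinnedChain ω₂ lam β γ).hamiltonian L) x =
      deriv (pinnedChain ω₂ lam β γ).U (x.1 i0) - deriv (pinnedChain ω₂ lam β γ).V (x.1 i1 - x.1 i0) := by
  have hU : Differentiable ℝ (pinnedChain ω₂ lam β γ).U :=
    (pinnedChain_contDiff_U ω₂ lam β γ (n := 1)).differentiable one_ne_zero
  have hV : Differentiable ℝ (pinnedChain ω₂ lam β γ).V :=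
    (pinnedChain_contDiff_V ω₂ lam β γ (n := 1)).differentiable one_ne_zero
  rw [(pinnedChain ω₂ lam β γ).partialQ_hamiltonian_eq_dPotential hU hV, OscillatorChain.dPotential_eq_closed]
  have h1 : ¬ (0 < i0.val) := by omega
  have h2 : i0.val + 1 < L := by omega
  rw [dif_neg h1, dif_pos h2, add_zero]
  have h3 : (⟨i0.val + 1, h2⟩ : Fin L) = i1 := Fin.ext (by simp [hi0, hi1])
  rw [h3]

/-- **A third site, uniformly in `L ≥ 2`.** There are a site `j₂ ≠ 0` and `ε ∈ [0, 1]` with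
`∂_{q_1} H = U'(q_1) + V'(q_1 − q_0) − ε V'(q_{j₂} − q_1)`: `j₂ = 2`, `ε = 1` if `L ≥ 3`, and `j₂ = 1`, `ε = 0` if
`L = 2` (site `1` is then the right end). [folklore] -/
theorem contact_exists_thirdSite (hL : 2 ≤ L) {i0 i1 : Fin L} (hi0 : i0.val = 0) (hi1 : i1.val = 1) :
    ∃ (j2 : Fin L) (ε : ℝ), 0 ≤ ε ∧ ε ≤ 1 ∧ j2 ≠ i0 ∧ ∀ x : PhaseSpace L,
      partialQ i1 ((pinnedChain ω₂ lam β γ).hamiltonian L) x =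
        deriv (pinnedChain ω₂ lam β γ).U (x.1 i1) + deriv (pinnedChain ω₂ lam β γ).V (x.1 i1 - x.1 i0) -
          ε * deriv (pinnedChain ω₂ lam β γ).V (x.1 j2 - x.1 i1) := by
  have hU : Differentiable ℝ (pinnedChain ω₂ lam β γ).U :=
    (pinnedChain_contDiff_U ω₂ lam β γ (n := 1)).differentiable one_ne_zero
  have hV : Differentiable ℝ (pinnedChain ω₂ lam β γ).V :=
    (pinnedChain_contDiff_V ω₂ lam β γ (n := 1)).differentiable one_ne_zero
  have h1 : 0 < i1.val := by omega
  have h0 : (⟨i1.val - 1, by omega⟩ : Fin L) = i0 := Fin.ext (by simp [hi0, hi1])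
  by_cases h3 : 2 < L
  · refine ⟨⟨2, h3⟩, 1, zero_le_one, le_rfl, fun h => ?_, fun x => ?_⟩
    · have := congrArg Fin.val h
      simp [hi0] at this
    · rw [(pinnedChain ω₂ lam β γ).partialQ_hamiltonian_eq_dPotential hU hV, OscillatorChain.dPotential_eq_closed,
        dif_pos h1, h0, one_mul]
      have h2 : i1.val + 1 < L := by omega
      rw [dif_pos h2]
      have h4 : (⟨i1.val + 1, h2⟩ : Fin L) = ⟨2, h3⟩ := Fin.ext (by simp [hi1])
      rw [h4]
  · refine ⟨i1, 0, le_rfl, zero_le_one, fun h => ?_, fun x => ?_⟩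
    · have := congrArg Fin.val h
      simp [hi0, hi1] at this
    · rw [(pinnedChain ω₂ lam β γ).partialQ_hamiltonian_eq_dPotential hU hV, OscillatorChain.dPotential_eq_closed,
        dif_pos h1, h0, zero_mul, sub_zero]
      have h2 : ¬ (i1.val + 1 < L) := by omega
      rw [dif_neg h2, sub_zero]

end Forces

/-! ## Calculus of the contact forces -/

section ForceCalculus

variable {ω₂ lam β γ : ℝ} {L : ℕ} {i0 i1 j2 : Fin L} {ε : ℝ} {F0 F1 : PhaseSpace L → ℝ}

/-- `U'` of the pinned chain is smooth. [folklore] -/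
theorem contact_contDiff_dU (ω₂ lam β γ : ℝ) {n : WithTop ℕ∞} :
    ContDiff ℝ n (deriv (pinnedChain ω₂ lam β γ).U) := by
  rw [show deriv (pinnedChain ω₂ lam β γ).U = fun q => ω₂ * q + lam * q ^ 3 from
    funext (pinnedChain_deriv_U ω₂ lam β γ)]
  fun_prop

/-- `V'` of the pinned chain is smooth. [folklore] -/
theorem contact_contDiff_dV (ω₂ lam β γ : ℝ) {n : WithTop ℕ∞} :
    ContDiff ℝ n (deriv (pinnedChain ω₂ lam β γ).V) := by
  rw [show deriv (pinnedChain ω₂ lam β γ).V = fun r => r + β * r ^ 3 from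
    funext (pinnedChain_deriv_V ω₂ lam β γ)]
  fun_prop

/-- `U''` of the pinned chain is smooth. [folklore] -/
theorem contact_contDiff_ddU (ω₂ lam β γ : ℝ) {n : WithTop ℕ∞} :
    ContDiff ℝ n (deriv (deriv (pinnedChain ω₂ lam β γ).U)) := by
  rw [show deriv (deriv (pinnedChain ω₂ lam β γ).U) = fun q => ω₂ + 3 * lam * q ^ 2 from
    funext (pinnedChain_deriv_deriv_U ω₂ lam β γ)]
  fun_prop

/-- `V''` of the pinned chain is smooth. [folklore] -/
theorem contact_contDiff_ddV (ω₂ lam β γ : ℝ) {n : WithTop ℕ∞} :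
    ContDiff ℝ n (deriv (deriv (pinnedChain ω₂ lam β γ).V)) := by
  rw [show deriv (deriv (pinnedChain ω₂ lam β γ).V) = fun r => 1 + 3 * β * r ^ 2 from
    funext (pinnedChain_deriv_deriv_V ω₂ lam β γ)]
  fun_prop

/-- `V'' = 1 + 3βr² ≥ 1` for `β ≥ 0` (the curl `∂_{q_0}F_1 = V''(q_1 − q_0)` has a sign). [folklore] -/
theorem contact_one_le_ddV (ω₂ lam γ : ℝ) (hβ : 0 ≤ β) (r : ℝ) :
    1 ≤ deriv (deriv (pinnedChain ω₂ lam β γ).V) r := by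
  rw [pinnedChain_deriv_deriv_V]
  nlinarith [sq_nonneg r]

/-- The force `F_0 = −U'(q_0) + V'(q_1 − q_0)` is smooth. [folklore] -/
theorem contact_contDiff_F0 {n : WithTop ℕ∞}
    (hF0 : F0 = fun y => -deriv (pinnedChain ω₂ lam β γ).U (y.1 i0) +
      deriv (pinnedChain ω₂ lam β γ).V (y.1 i1 - y.1 i0)) :
    ContDiff ℝ n F0 := by
  have hU := contact_contDiff_dU ω₂ lam β γ (n := n)
  have hV := contact_contDiff_dV ω₂ lam β γ (n := n)
  rw [hF0]
  exact ((hU.comp (contact_contDiff_fst i0)).neg).add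
    (hV.comp ((contact_contDiff_fst i1).sub (contact_contDiff_fst i0)))

/-- The force `F_1 = −U'(q_1) − V'(q_1 − q_0) + ε V'(q_{j₂} − q_1)` is smooth. [folklore] -/
theorem contact_contDiff_F1 {n : WithTop ℕ∞}
    (hF1 : F1 = fun y => -deriv (pinnedChain ω₂ lam β γ).U (y.1 i1) -
      deriv (pinnedChain ω₂ lam β γ).V (y.1 i1 - y.1 i0) + ε * deriv (pinnedChain ω₂ lam β γ).V (y.1 j2 - y.1 i1)) :
    ContDiff ℝ n F1 := by
  have hU := contact_contDiff_dU ω₂ lam β γ (n := n)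
  have hV := contact_contDiff_dV ω₂ lam β γ (n := n)
  rw [hF1]
  exact (((hU.comp (contact_contDiff_fst i1)).neg).sub
    (hV.comp ((contact_contDiff_fst i1).sub (contact_contDiff_fst i0)))).add
    (contDiff_const.mul (hV.comp ((contact_contDiff_fst j2).sub (contact_contDiff_fst i1))))

/-- `∂_{p_j} F_0 = 0`. [folklore] -/
theorem contact_partialP_F0
    (hF0 : F0 = fun y => -deriv (pinnedChain ω₂ lam β γ).U (y.1 i0) +
      deriv (pinnedChain ω₂ lam β γ).V (y.1 i1 - y.1 i0)) (j : Fin L) (x : PhaseSpace L) :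
    partialP j F0 x = 0 := by
  rw [hF0]
  exact contact_partialP_of_fst (fun q => -deriv (pinnedChain ω₂ lam β γ).U (q i0) +
    deriv (pinnedChain ω₂ lam β γ).V (q i1 - q i0)) j x

/-- `∂_{p_j} F_1 = 0`. [folklore] -/
theorem contact_partialP_F1
    (hF1 : F1 = fun y => -deriv (pinnedChain ω₂ lam β γ).U (y.1 i1) -
      deriv (pinnedChain ω₂ lam β γ).V (y.1 i1 - y.1 i0) + ε * deriv (pinnedChain ω₂ lam β γ).V (y.1 j2 - y.1 i1))
    (j : Fin L) (x : PhaseSpace L) :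
    partialP j F1 x = 0 := by
  rw [hF1]
  exact contact_partialP_of_fst (fun q => -deriv (pinnedChain ω₂ lam β γ).U (q i1) -
    deriv (pinnedChain ω₂ lam β γ).V (q i1 - q i0) + ε * deriv (pinnedChain ω₂ lam β γ).V (q j2 - q i1)) j x

/-- `F_0`, `F_1` are even under momentum reversal (functions of the positions). [folklore] -/
theorem contact_F_neg_momentum
    (hF0 : F0 = fun y => -deriv (pinnedChain ω₂ lam β γ).U (y.1 i0) +
      deriv (pinnedChain ω₂ lam β γ).V (y.1 i1 - y.1 i0))
    (hF1 : F1 = fun y => -deriv (pinnedChain ω₂ lam β γ).U (y.1 i1) -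
      deriv (pinnedChain ω₂ lam β γ).V (y.1 i1 - y.1 i0) + ε * deriv (pinnedChain ω₂ lam β γ).V (y.1 j2 - y.1 i1))
    (x : PhaseSpace L) :
    F0 (x.1, -x.2) = F0 x ∧ F1 (x.1, -x.2) = F1 x := by
  subst hF0 hF1
  exact ⟨rfl, rfl⟩

end ForceCalculus

/-- **Registered helper `contact_forcesClosedForm` (R4 `stub_contactFormation`, line `cold-bath-relocation-walk`): THE TWO CONTACT
FORCES IN CLOSED FORM, UNIFORMLY IN `L ≥ 2`.**  `∂_{q_0}H = U'(q_0) − V'(q_1 − q_0)` and, for a third site `j₂ ≠ 0` and an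
`ε ∈ [0, 1]` (`(j₂, ε) = (2, 1)` if `L ≥ 3`, `(1, 0)` if `L = 2`), `∂_{q_1}H = U'(q_1) + V'(q_1 − q_0) − ε V'(q_{j₂} − q_1)`; this is the
only place where the passive tail enters the curl certificate (through site `2`), whence its `L`-uniformity. [folklore] -/
theorem contact_forcesClosedForm : ∀ {ω₂ lam β γ : ℝ} {L : ℕ}, 2 ≤ L → ∀ {i0 i1 : Fin L}, i0.val = 0 → i1.val = 1 → (∀ x : PhaseSpace L, partialQ i0 ((pinnedChain ω₂ lam β γ).hamiltonian L) x = deriv (pinnedChain ω₂ lam β γ).U (x.1 i0) - deriv (pinnedChain ω₂ lam β γ).V (x.1 i1 - x.1 i0)) ∧ ∃ (j2 : Fin L) (ε : ℝ), 0 ≤ ε ∧ ε ≤ 1 ∧ j2 ≠ i0 ∧ ∀ x : PhaseSpace L, partialQ i1 ((pinnedChain ω₂ lam β γ).hamiltonian L) x = deriv (pinnedChain ω₂ lam β γ).U (x.1 i1) + deriv (pinnedChain ω₂ lam β γ).V (x.1 i1 - x.1 i0) - ε * deriv (pinnedChain ω₂ lam β γ).V (x.1 j2 - x.1 i1) :=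
  fun hL _ _ hi0 hi1 => ⟨contact_partialQ_hamiltonian_zero hL hi0 hi1, contact_exists_thirdSite hL hi0 hi1⟩

end Summit.AtomisticToContinuum.FouriersLaw.Cruxes.ConductanceLowerBound.ColdBathRelocationWalk

end
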